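import Summits.SmoothPoincare4.SmoothPoincare4.Theorems.ConvexBisectionAcyclicBisectionExistsSeamTwistSignStraighten
import Summits.SmoothPoincare4.SmoothPoincare4.Theorems.ConvexBisectionAcyclicBisectionExistsBeltPageClause
import Summits.SmoothPoincare4.SmoothPoincare4.Theorems.ConvexBisectionAcyclicBisectionExistsDualHandlePlumbing
import Literature.Topology.FourManifolds.HandleAttachingMapsTransport
import Literature.Topology.FourManifolds.LefschetzBaseOpenBook
import HarnessLib

/-!
# Dual handles, node Hgap ("T3c-3 WITH DATA"), part A-1: ONE fibred isotopy of the cap straightens ALL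
# dual attaching circles into flat pages
(sub-goal of stub `stub_T3_dualPresentation` (T3), line `modp-braid-orbits`, crux
`ConvexBisection.AcyclicBisectionExists`, item stmt-SmoothPoincare4-10508; wave 6, lead c5, worker G1;
registered sub-goal `helper_dual_straighten`)

Let `(X, h, D, bX, Ψ)` be a fibred model of a Lefschetz link `l` over the cap `Base g` (page clause on
the seam) and let `dualMap D bX (bBase g) Ψ col κ δ … k` be the dual attaching map of the `k`-th handle
on the cap (V5, `…DualHandlePlumbing.lean`).  Its attaching circle is `Ψ` of the `k`-th belt circle
(`attachingCircle_dualMap`), a circle of DEEP belt points of the seam, hence (V4's belt clause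
`helper_belt_pageClause`) it lies in the EXTENDED page of direction `pageDir |l| k`:
`rho = 1/4`, `w = c · pageDir |l| k`, `c > 0` (§1).  The `N` dual circles are compact, so `‖w‖ ≥ 2m > 0`
on all of them for one margin `m` (§2), and X3's universal straightening `strIso g m hm` of ST2
(`helper_strFlow_page`: a `rho`-preserving, `w`-proportional ambient isotopy of `Base g` whose time-`1`
map flattens every point of an extended page with `‖w‖ ≥ m` into the flat page of the same direction,
`str_flat`) carries, AT ONCE, the `k`-th dual circle into `page g (pageDir |l| k)` for every `k` (§3);
read on the transported attaching maps `(dualMap … k).transport ((strIso g m hm).toDiffeomorph 1)`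
(`HandleAttachingMap.attachingCircle_transport`) this is the page clause of the straightened dual
presentation (§4, with the suffix bookkeeping `l = P ++ N`, `k = |P| + j` of T3).

Everything is proved; no named facts, no `sorry`, no `def`.

## References
* R. İ. Baykur, *Kähler decomposition of 4-manifolds*, AGT 6 (2006), proof of Thm. 5.1, p. 13. [Baykur2006]
* J. B. Etnyre, T. Fuller, *Realizing 4-manifolds as achiral Lefschetz fibrations*, IMRN (2006), Thm. 1 (proof, p. 8). [EtnyreFuller2006]
-/

noncomputable section

-- the prescribed namespace `Summit.<P>.<Sub>.…` duplicates `SmoothPoincare4` (P = Sub)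
set_option linter.dupNamespace false

open scoped Manifold ContDiff Topology

namespace Summit.SmoothPoincare4.SmoothPoincare4.Theorems.AcyclicBisectionExists.ModpBraidOrbits

open Set Function Metric
open Literature.Topology.FourManifolds Literature.Topology.FourManifolds.HandleAttachingMap
  Literature.Topology.FourManifolds.LefschetzBase

namespace HgapStraighten

variable {g : ℕ} {l : List ((Fin g ⊕ Fin g → ℤ) × Bool)} {h : Fin l.length → HandleAttachingMap 3 2 (Base g)}
  {X : Type} [TopologicalSpace X] [T2Space X] [SecondCountableTopology X] [CompactSpace X]
  [ChartedSpace (EuclideanHalfSpace 4) X] [IsManifold (𝓡∂ 4) ∞ X]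

/-! ## §1 A dual attaching circle lies in the extended page of its letter -/

/-- **The points of the `k`-th dual attaching circle lie on `∂ Base g` in the extended page of direction
`pageDir |l| k`**: `rho = 1/4` and `w = c · pageDir |l| k` with `c > 0` (the dual circle is `Ψ` of the
belt circle, a circle of deep belt points of the seam, and V4's belt page clause).
[cite: EtnyreFuller2006, Thm. 1 (proof, p. 8)] -/
theorem dual_circle_extendedPage (hlink : IsLefschetzLink g l h) (D : MultiAttachmentData h (𝓡∂ 4) X)
    (bX : BoundaryData (𝓡∂ 4) X (𝓡 3)) (Ψ : bX.carrier ≃ₘ⟮𝓡 3, 𝓡 3⟯ (bBase g).carrier)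
    (hpage : ∀ (y : bX.carrier) (a : ↥(coresComplement h)), bX.incl y = D.jA a →
      ∃ c : ℝ, 0 < c ∧ w g ((bBase g).incl (Ψ y)).1 = (c : ℂ) * w g (a : Base g).1)
    (col : (BoundaryManifold.boundaryData 3 (Base g)).Collar) (κ δ : ℝ) (hκ : 0 < κ) (hκ1 : κ ≤ 1)
    (hδ : 0 < δ) (hδ2 : δ ≤ 1 / 2) (k : Fin l.length) (θ : sphere (0 : EuclideanSpace ℝ (Fin 2)) 1) :
    rho g ((dualMap D bX (bBase g) Ψ col κ δ hκ hκ1 hδ hδ2 k).attachingCircle θ).1 = 1 / 4 ∧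
      ∃ c : ℝ, 0 < c ∧ w g ((dualMap D bX (bBase g) Ψ col κ δ hκ hκ1 hδ hδ2 k).attachingCircle θ).1 =
        (c : ℂ) * pageDir l.length k := by
  obtain ⟨z, hz, hcirc⟩ := attachingCircle_dualMap D bX (bBase g) Ψ col κ δ hκ hκ1 hδ hδ2 k θ
  rw [hcirc]
  refine ⟨rho_inclB g (Ψ z), ?_⟩
  have hdeep : bX.incl z ∉ range D.jA := by
    rintro ⟨a, ha⟩
    exact jA_ne_jB_beltCirclePt D k a θ (ha.trans hz)
  exact helper_belt_pageClause g l X h D bX Ψ hlink hpage z k (beltCirclePt θ) hz hdeep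

/-- The norm of `w` at a point of the `k`-th dual attaching circle is the positive coefficient `c`
(`‖pageDir‖ = 1`); in particular it is positive. [folklore] -/
theorem norm_w_dual_circle_pos (hlink : IsLefschetzLink g l h) (D : MultiAttachmentData h (𝓡∂ 4) X)
    (bX : BoundaryData (𝓡∂ 4) X (𝓡 3)) (Ψ : bX.carrier ≃ₘ⟮𝓡 3, 𝓡 3⟯ (bBase g).carrier)
    (hpage : ∀ (y : bX.carrier) (a : ↥(coresComplement h)), bX.incl y = D.jA a →
      ∃ c : ℝ, 0 < c ∧ w g ((bBase g).incl (Ψ y)).1 = (c : ℂ) * w g (a : Base g).1)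
    (col : (BoundaryManifold.boundaryData 3 (Base g)).Collar) (κ δ : ℝ) (hκ : 0 < κ) (hκ1 : κ ≤ 1)
    (hδ : 0 < δ) (hδ2 : δ ≤ 1 / 2) (k : Fin l.length) (θ : sphere (0 : EuclideanSpace ℝ (Fin 2)) 1) :
    0 < ‖w g ((dualMap D bX (bBase g) Ψ col κ δ hκ hκ1 hδ hδ2 k).attachingCircle θ).1‖ := by
  obtain ⟨-, c, hc, hw⟩ := dual_circle_extendedPage hlink D bX Ψ hpage col κ δ hκ hκ1 hδ hδ2 k θ
  rw [hw, norm_mul, norm_pageDir, mul_one, Complex.norm_real, Real.norm_eq_abs, abs_of_pos hc]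
  exact hc

/-! ## §2 One margin below `‖w‖` on all dual attaching circles -/

/-- **A uniform margin**: there is `m > 0` with `2m ≤ ‖w‖` at every point of every dual attaching
circle (finitely many compact circles on which `‖w‖` is continuous and positive). [folklore] -/
theorem exists_dual_margin (hlink : IsLefschetzLink g l h) (D : MultiAttachmentData h (𝓡∂ 4) X)
    (bX : BoundaryData (𝓡∂ 4) X (𝓡 3)) (Ψ : bX.carrier ≃ₘ⟮𝓡 3, 𝓡 3⟯ (bBase g).carrier)
    (hpage : ∀ (y : bX.carrier) (a : ↥(coresComplement h)), bX.incl y = D.jA a →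
      ∃ c : ℝ, 0 < c ∧ w g ((bBase g).incl (Ψ y)).1 = (c : ℂ) * w g (a : Base g).1)
    (col : (BoundaryManifold.boundaryData 3 (Base g)).Collar) (κ δ : ℝ) (hκ : 0 < κ) (hκ1 : κ ≤ 1)
    (hδ : 0 < δ) (hδ2 : δ ≤ 1 / 2) :
    ∃ m : ℝ, 0 < m ∧ ∀ (k : Fin l.length) (θ : sphere (0 : EuclideanSpace ℝ (Fin 2)) 1),
      2 * m ≤ ‖w g ((dualMap D bX (bBase g) Ψ col κ δ hκ hκ1 hδ hδ2 k).attachingCircle θ).1‖ := by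
  -- the norm of `w` along the `k`-th dual circle
  let f : Fin l.length → sphere (0 : EuclideanSpace ℝ (Fin 2)) 1 → ℝ :=
    fun k θ => ‖w g ((dualMap D bX (bBase g) Ψ col κ δ hκ hκ1 hδ hδ2 k).attachingCircle θ).1‖
  have hf : ∀ k, Continuous (f k) := fun k =>
    ((contDiff_w g).continuous.comp (continuous_subtype_val.comp
      (dualMap D bX (bBase g) Ψ col κ δ hκ hκ1 hδ hδ2 k).continuous_attachingCircle)).norm
  -- a minimum on each (compact, non-empty) circle
  have hmin : ∀ k, ∃ θ₀, ∀ θ, f k θ₀ ≤ f k θ := fun k => by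
    obtain ⟨θ₀, -, hθ₀⟩ := isCompact_univ.exists_isMinOn (univ_nonempty (α := sphere
      (0 : EuclideanSpace ℝ (Fin 2)) 1)) (hf k).continuousOn
    exact ⟨θ₀, fun θ => hθ₀ (mem_univ θ)⟩
  choose θ₀ hθ₀ using hmin
  rcases isEmpty_or_nonempty (Fin l.length) with he | hne
  · exact ⟨1, one_pos, fun k => isEmptyElim k⟩
  · -- a minimum over the finitely many circles
    obtain ⟨k₀, hk₀⟩ := Finite.exists_min fun k => f k (θ₀ k)
    refine ⟨f k₀ (θ₀ k₀) / 2, ?_, fun k θ => ?_⟩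
    · exact half_pos (norm_w_dual_circle_pos hlink D bX Ψ hpage col κ δ hκ hκ1 hδ hδ2 k₀ (θ₀ k₀))
    · calc 2 * (f k₀ (θ₀ k₀) / 2) = f k₀ (θ₀ k₀) := by ring
        _ ≤ f k (θ₀ k) := hk₀ k
        _ ≤ f k θ := hθ₀ k θ

/-! ## §3 The universal straightening flattens all dual circles at once -/

/-- **Simultaneous straightening**: if `2m ≤ ‖w‖` on the dual attaching circles then the time-`1` map of
X3's universal straightening `strIso g m hm` (ST2) carries the `k`-th dual attaching circle into the FLAT
page `page g (pageDir |l| k)`, for every `k` (`str_flat` at a point of the extended page with `rho = 1/4`,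
`‖w‖ ≥ m`, direction `pageDir |l| k`). [cite: Baykur2006, Thm. 5.1 (proof, p. 13)] -/
theorem str_dual_circle_mem_page (hlink : IsLefschetzLink g l h) (D : MultiAttachmentData h (𝓡∂ 4) X)
    (bX : BoundaryData (𝓡∂ 4) X (𝓡 3)) (Ψ : bX.carrier ≃ₘ⟮𝓡 3, 𝓡 3⟯ (bBase g).carrier)
    (hpage : ∀ (y : bX.carrier) (a : ↥(coresComplement h)), bX.incl y = D.jA a →
      ∃ c : ℝ, 0 < c ∧ w g ((bBase g).incl (Ψ y)).1 = (c : ℂ) * w g (a : Base g).1)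
    (col : (BoundaryManifold.boundaryData 3 (Base g)).Collar) (κ δ : ℝ) (hκ : 0 < κ) (hκ1 : κ ≤ 1)
    (hδ : 0 < δ) (hδ2 : δ ≤ 1 / 2) {m : ℝ} (hm : 0 < m)
    (hmar : ∀ (k : Fin l.length) (θ : sphere (0 : EuclideanSpace ℝ (Fin 2)) 1),
      2 * m ≤ ‖w g ((dualMap D bX (bBase g) Ψ col κ δ hκ hκ1 hδ hδ2 k).attachingCircle θ).1‖)
    (k : Fin l.length) (θ : sphere (0 : EuclideanSpace ℝ (Fin 2)) 1) :
    (strIso g m hm).toFun 1 ((dualMap D bX (bBase g) Ψ col κ δ hκ hκ1 hδ hδ2 k).attachingCircle θ) ∈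
      page g (pageDir l.length k) := by
  obtain ⟨hρ, c, hc, hw⟩ := dual_circle_extendedPage hlink D bX Ψ hpage col κ δ hκ hκ1 hδ hδ2 k θ
  refine str_flat m hm _ (pageDir l.length k) (norm_pageDir _ _) hρ ?_ ⟨c, hc, hw⟩
  have h2 := hmar k θ
  linarith

/-- **The page clause of the straightened dual presentation**: the attaching circle of the transported
attaching map `(dualMap … k).transport ((strIso g m hm).toDiffeomorph 1)` (which is
`strIso g m hm 1 ∘ (dual circle)`, `attachingCircle_transport`) lies in `page g (pageDir |l| k)`.
[cite: Baykur2006, Thm. 5.1 (proof, p. 13)] -/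
theorem transport_dual_circle_mem_page (hlink : IsLefschetzLink g l h) (D : MultiAttachmentData h (𝓡∂ 4) X)
    (bX : BoundaryData (𝓡∂ 4) X (𝓡 3)) (Ψ : bX.carrier ≃ₘ⟮𝓡 3, 𝓡 3⟯ (bBase g).carrier)
    (hpage : ∀ (y : bX.carrier) (a : ↥(coresComplement h)), bX.incl y = D.jA a →
      ∃ c : ℝ, 0 < c ∧ w g ((bBase g).incl (Ψ y)).1 = (c : ℂ) * w g (a : Base g).1)
    (col : (BoundaryManifold.boundaryData 3 (Base g)).Collar) (κ δ : ℝ) (hκ : 0 < κ) (hκ1 : κ ≤ 1)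
    (hδ : 0 < δ) (hδ2 : δ ≤ 1 / 2) {m : ℝ} (hm : 0 < m)
    (hmar : ∀ (k : Fin l.length) (θ : sphere (0 : EuclideanSpace ℝ (Fin 2)) 1),
      2 * m ≤ ‖w g ((dualMap D bX (bBase g) Ψ col κ δ hκ hκ1 hδ hδ2 k).attachingCircle θ).1‖)
    (k : Fin l.length) (θ : sphere (0 : EuclideanSpace ℝ (Fin 2)) 1) :
    ((dualMap D bX (bBase g) Ψ col κ δ hκ hκ1 hδ hδ2 k).transport
        ((strIso g m hm).toDiffeomorph 1)).attachingCircle θ ∈ page g (pageDir l.length k) := by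
  rw [attachingCircle_transport_apply, AmbientIsotopy.coe_toDiffeomorph]
  exact str_dual_circle_mem_page hlink D bX Ψ hpage col κ δ hκ hκ1 hδ hδ2 hm hmar k θ

/-! ## §4 Suffix bookkeeping for T3: `l = P ++ N`, `k = |P| + j` -/

/-- The direction of the `j`-th suffix letter: `pageDir |P ++ N| (sfx j) = pageDir |P ++ N| (|P| + j)`
(the suffix position `Fin.cast _ (Fin.natAdd |P| j)` has value `|P| + j`). [folklore] -/
theorem pageDir_sfx (P N : List ((Fin g ⊕ Fin g → ℤ) × Bool)) (j : Fin N.length) :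
    pageDir (P ++ N).length ((Fin.cast List.length_append.symm (Fin.natAdd P.length j) :
      Fin (P ++ N).length) : ℕ) = pageDir (P ++ N).length (P.length + j) := rfl

/-- **The page clause of the straightened dual presentation of the SUFFIX handles** (the form consumed by
the Hgap assembly): the `j`-th transported dual attaching circle lies in
`page g (pageDir |P ++ N| (|P| + j))`. [cite: Baykur2006, Thm. 5.1 (proof, p. 13)] -/
theorem transport_dual_circle_mem_page_sfx {P N : List ((Fin g ⊕ Fin g → ℤ) × Bool)}
    {h : Fin (P ++ N).length → HandleAttachingMap 3 2 (Base g)} (hlink : IsLefschetzLink g (P ++ N) h)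
    (D : MultiAttachmentData h (𝓡∂ 4) X)
    (bX : BoundaryData (𝓡∂ 4) X (𝓡 3)) (Ψ : bX.carrier ≃ₘ⟮𝓡 3, 𝓡 3⟯ (bBase g).carrier)
    (hpage : ∀ (y : bX.carrier) (a : ↥(coresComplement h)), bX.incl y = D.jA a →
      ∃ c : ℝ, 0 < c ∧ w g ((bBase g).incl (Ψ y)).1 = (c : ℂ) * w g (a : Base g).1)
    (col : (BoundaryManifold.boundaryData 3 (Base g)).Collar) (κ δ : ℝ) (hκ : 0 < κ) (hκ1 : κ ≤ 1)
    (hδ : 0 < δ) (hδ2 : δ ≤ 1 / 2) {m : ℝ} (hm : 0 < m)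
    (hmar : ∀ (k : Fin (P ++ N).length) (θ : sphere (0 : EuclideanSpace ℝ (Fin 2)) 1),
      2 * m ≤ ‖w g ((dualMap D bX (bBase g) Ψ col κ δ hκ hκ1 hδ hδ2 k).attachingCircle θ).1‖)
    (j : Fin N.length) (θ : sphere (0 : EuclideanSpace ℝ (Fin 2)) 1) :
    ((dualMap D bX (bBase g) Ψ col κ δ hκ hκ1 hδ hδ2
        (Fin.cast List.length_append.symm (Fin.natAdd P.length j))).transport
        ((strIso g m hm).toDiffeomorph 1)).attachingCircle θ ∈
      page g (pageDir (P ++ N).length (P.length + j)) := by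
  rw [← pageDir_sfx P N j]
  exact transport_dual_circle_mem_page hlink D bX Ψ hpage col κ δ hκ hκ1 hδ hδ2 hm hmar _ θ

end HgapStraighten

open HgapStraighten

/-! ## §5 Registered helper -/

/-- **Sub-goal `helper_dual_straighten` of stub `stub_T3_dualPresentation`** (node Hgap, part A-1; wave 6,
lead c5): for a fibred model `(X, h, D, bX, Ψ)` of a Lefschetz link `l` over `Base g` and the dual attaching
maps of its handles on the cap, there is ONE margin `m > 0` with `2m ≤ ‖w‖` on all dual attaching circles,
and the time-`1` map of X3's universal straightening `strIso g m hm` (a `rho`-preserving, `w`-proportional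
ambient isotopy of the cap) carries the `k`-th dual attaching circle into the flat page
`page g (pageDir |l| k)` for every `k` simultaneously. [cite: Baykur2006, Thm. 5.1 (proof, p. 13)] -/
theorem helper_dual_straighten : ∀ (g : ℕ) (l : List ((Fin g ⊕ Fin g → ℤ) × Bool)) (h : Fin l.length → Literature.Topology.FourManifolds.HandleAttachingMap 3 2 (Literature.Topology.FourManifolds.LefschetzBase.Base g)) (_ : Literature.Topology.FourManifolds.LefschetzBase.IsLefschetzLink g l h) {X : Type} [TopologicalSpace X] [T2Space X] [SecondCountableTopology X] [CompactSpace X] [ChartedSpace (EuclideanHalfSpace 4) X] [IsManifold (𝓡∂ 4) ∞ X] (D : Literature.Topology.FourManifolds.HandleAttachingMap.MultiAttachmentData h (𝓡∂ 4) X) (bX : Literature.Topology.FourManifolds.BoundaryData (𝓡∂ 4) X (𝓡 3)) (Ψ : bX.carrier ≃ₘ⟮𝓡 3, 𝓡 3⟯ (Literature.Topology.FourManifolds.LefschetzBase.bBase g).carrier) (_ : ∀ (y : bX.carrier) (a : ↥(Literature.Topology.FourManifolds.HandleAttachingMap.coresComplement h)), bX.incl y = D.jA a → ∃ c : ℝ,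 0 < c ∧ Literature.Topology.FourManifolds.LefschetzBase.w g ((Literature.Topology.FourManifolds.LefschetzBase.bBase g).incl (Ψ y)).1 = (c : ℂ) * Literature.Topology.FourManifolds.LefschetzBase.w g (a : Literature.Topology.FourManifolds.LefschetzBase.Base g).1) (col : (Literature.Topology.FourManifolds.BoundaryManifold.boundaryData 3 (Literature.Topology.FourManifolds.LefschetzBase.Base g)).Collar) (κ δ : ℝ) (hκ : 0 < κ) (hκ1 : κ ≤ 1) (hδ : 0 < δ) (hδ2 : δ ≤ 1 / 2), ∃ (m : ℝ) (hm : 0 < m), (∀ (k : Fin l.length) (θ : Metric.sphere (0 : EuclideanSpace ℝ (Fin 2)) 1), 2 * m ≤ ‖Literature.Topology.FourManifolds.LefschetzBase.w g ((Summit.SmoothPoincare4.SmoothPoincare4.Theorems.AcyclicBisectionExists.ModpBraidOrbits.dualMap D bX (Literature.Topology.FourManifolds.LefschetzBase.bBase g) Ψ col κ δ hκ hκ1 hδ hδ2 k).attachingCircle θ).1‖) ∧ (∀ (k : Fin l.length) (θ : Metric.sphere (0 : EuclideanSpace ℝ (Fin 2)) 1), ((Summit.SmoothPoincare4.SmoothPoincare4.Theorems.AcyclicBisectionExists.ModpBraidOrbits.dualMap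 D bX (Literature.Topology.FourManifolds.LefschetzBase.bBase g) Ψ col κ δ hκ hκ1 hδ hδ2 k).transport ((Summit.SmoothPoincare4.SmoothPoincare4.Theorems.AcyclicBisectionExists.ModpBraidOrbits.strIso g m hm).toDiffeomorph 1)).attachingCircle θ ∈ Literature.Topology.FourManifolds.LefschetzBase.page g (Literature.Topology.FourManifolds.LefschetzBase.pageDir l.length k)) := by
  intro g l h hlink X _ _ _ _ _ _ D bX Ψ hpage col κ δ hκ hκ1 hδ hδ2
  obtain ⟨m, hm, hmar⟩ := exists_dual_margin hlink D bX Ψ hpage col κ δ hκ hκ1 hδ hδ2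
  exact ⟨m, hm, hmar, fun k θ => transport_dual_circle_mem_page hlink D bX Ψ hpage col κ δ hκ hκ1 hδ hδ2 hm hmar k θ⟩

end Summit.SmoothPoincare4.SmoothPoincare4.Theorems.AcyclicBisectionExists.ModpBraidOrbits

end
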